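import Mathlib
import HarnessLib
import Summits.NavierStokesRegularity.NavierStokesRegularity.Theorems.UnthreadedRigidityDoorUnthreadedRigidityPrecessionSlicesC2
import Summits.NavierStokesRegularity.NavierStokesRegularity.Theorems.ThreadingFluxPoloidalLiouvillePrecessionShortPeriodCollapse

/-!
# Route `UnthreadedRigidityDoor`, item `UnthreadedRigidity` (W2, stmt-NavierStokesRegularity-27585) — crux idea «precession-gap» (ns-idea-15): the W2-SHAPED RUNG
# G `FastPrecessionUnthreadedRigidity` is now UNCONDITIONAL

Cell ns-regularity-ideate, seat ns-poloidal-K2-p2 g13.  One application: the conditional rung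
`…UnthreadedRigidityPrecessionSlicesC2.fastPrecessionUnthreadedRigidity_of_shortPeriodCollapse'` (p679393, K2-p2 g12: G from D alone, the regularity price P3
`boundedHonestMildSlicesC2` already discharged there) fed with D `…PrecessionShortPeriodCollapse.shortPeriodCollapse` (this seat).  Statement = the body of
`Precession.FastPrecessionUnthreadedRigidity` (`Cruxes/PoloidalLiouville/PrecessionSketch.lean` v3) VERBATIM up to unfolding the sketch-local definitions (exactly
as in p675054 / p679393).

WHAT IT SAYS (honest): a continuous, divergence-free, honest Oseen-mild (on `ℝ`) rigidly precessing state about an axis through `x₀` whose vorticity is tangent to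
the spheres about `x₀`, with FAST precession `C‖V‖²_∞ ≤ |Ω|`, is equivariant under a non-zero skew map `A` (`D(u t)(x)·A(x−x₀) = A(u t x)`) — the conclusion shape
of 27585.  Decides the fast half of the precessing stratum only; W2 `stub_shearedRigidity` and 27585 stay OPEN; movement as an item = 0.  No claim about
Navier–Stokes regularity.
-/

noncomputable section

-- the summit and its single sub-problem share the name (CONVENTIONS §1), as in every Theorems file
set_option linter.dupNamespace false

namespace Summit.NavierStokesRegularity.NavierStokesRegularity.Theorems.UnthreadedRigidityDoorUnthreadedRigidityPrecessionFastW2Unconditional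

open Set Function Filter Topology Metric MeasureTheory
open scoped RealInnerProductSpace InnerProductSpace
open Literature.Analysis Literature.Analysis.FluidPDE Literature.Analysis.UnboundedOperators
open Summit.NavierStokesRegularity.NavierStokesRegularity.Theorems.UnthreadedRigidityDoorUnthreadedRigidityPrecessionSlicesC2
open Summit.NavierStokesRegularity.NavierStokesRegularity.Theorems.ThreadingFluxPoloidalLiouvillePrecessionShortPeriodCollapse

/-- **W2 RUNG G `FastPrecessionUnthreadedRigidity` (body VERBATIM, sketch-local definitions unfolded), UNCONDITIONAL.**
`:= fastPrecessionUnthreadedRigidity_of_shortPeriodCollapse' shortPeriodCollapse`. -/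
theorem fastPrecessionUnthreadedRigidity :
    ∃ C : ℝ, 0 < C ∧ ∀ (u : ℝ → EuclideanSpace ℝ (Fin 3) → EuclideanSpace ℝ (Fin 3)) (x₀ : EuclideanSpace ℝ (Fin 3)) (Ω B : ℝ)
      (V : EuclideanSpace ℝ (Fin 3) → EuclideanSpace ℝ (Fin 3)),
      Continuous (uncurry u) → (∀ t, VectorCalculus.IsDivFree (u t)) →
      (∀ s ∈ (univ : Set ℝ), ∀ t ∈ (univ : Set ℝ), s < t → ∀ x,
        u t x = heatExtension (u s) (t - s) x - oseenDuhamel 1 s u u t x) →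
      (∀ t x, u t x = rotZ (Ω * t) (V (rotZ (-(Ω * t)) (x - x₀)))) → (∀ x, ‖V x‖ ≤ B) → C * B ^ 2 ≤ |Ω| →
      (∀ t x, inner ℝ (curl (u t) x) (x - x₀) = 0) →
      ∃ A : EuclideanSpace ℝ (Fin 3) →L[ℝ] EuclideanSpace ℝ (Fin 3), (∀ x, inner ℝ (A x) x = 0) ∧ A ≠ 0 ∧
        ∀ t x, fderiv ℝ (u t) x (A (x - x₀)) - A (u t x) = 0 :=
  fastPrecessionUnthreadedRigidity_of_shortPeriodCollapse' shortPeriodCollapse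

end Summit.NavierStokesRegularity.NavierStokesRegularity.Theorems.UnthreadedRigidityDoorUnthreadedRigidityPrecessionFastW2Unconditional

end
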